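import Summits.ResolutionOfSingularities.ResolutionOfSingularities.Theorems.MarkedTransferCampaignG1PnegaObligationF3hsBdd
import Summits.ResolutionOfSingularities.ResolutionOfSingularities.Theorems.MarkedTransferCampaignG1PnegaObligationF34Kernel
import Summits.ResolutionOfSingularities.ResolutionOfSingularities.Theorems.MarkedTransferCampaignW12SandwichA1Calibration
import Literature.AlgebraicGeometry.Resolution.TaylorUnitOrderCriterion
import HarnessLib

/-!
# [OURS · L1 G1 ℘nega-INTERFACE · cell K13-2, PART B] F3hs^{<p^e} (`PnegaObligation.F3hsBddAt`, Part A
# `…G1PnegaObligationF3hsBdd.lean`) FAILS for the guarded families of Def. 5.1 shape on the Frobenius-sandwich carriers SWρ / SW —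
# the boundary summand `d·m = a` escapes; parametric witness + hypothesis-free instances at both placements of record
# (affine line `K[x]`; `K[x]_{(x)}` with the tree's `taylorHS`). Kernel by res-D-pv-031 (K13-2, res-D-plan-1 2026-08-27T03:30:27Z);
# carrier res-L1-type-o2. See Part A's header for the full record, the cell text and the honest framing (repeated in short below).

WHAT IS DECIDED HERE. §4 parametric ✗ (`not_F3hsBddAt_sandwichRhoFamily`, `not_F3hsBddAt_sandwichFamily`): any ring `O` of
characteristic `p`, any HS homomorphism `T` with `D^{[0]} = id` and `D^{[e_j]} y = 1`, `(y)`-adic placement `P n = (y^n)`, class regime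
`m = q = p^e`, `e ≥ 1`, `y^q ∉ (y^{2q})`: `y^{q+1} ∈ ℘̃_swρ(E,−q)` (summand `d = 1`, `∂ = id`), `D^{[e_j]}(y^q·y) = y^q` (Part A
`hsComponent_pow_pow_mul`), and `℘̃_swρ(E,−q−1) ⊆ ℘̃_sw(E,−q−1) ⊆ (y^{2q})` (guard forces `d ≥ 2`; `(y^{dq}) = ρ^e(y^d)·O` is stable
under every `ρ^e(O)`-linear map). §5 instances: `not_F3hsBddAt_sandwichRhoFamily_affineLine` (every `T` with `D^{[1]}x = 1`),
`…_affineLine_taylor` (polynomial Taylor system `polyTaylorHS`), `not_F3hsBddAt_sandwichRhoFamily_originLocalization'` (tree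
`Resolution.OriginLocalization.taylorHS K 1`, `[Field K] [CharP K p]`, `e ≥ 1`), and the SW twins.

CARRIER NOTE (res-L1-type-o2 g6): KERNEL by res-D-pv-031 (HOME draft `D/res-D-pv-031/PnegaObligationF3hsBdd.partB.draft.lean` ef5b7402473d511e), carried as Part B of (verbatim except: the restated `idealOfVars_fin_one_pow` replaced by the tree's `Campaign.W12.idealOfVars_fin_one_pow` — gate dedup.landed — and its import added) `MarkedTransferCampaignG1PnegaObligationF3hsBdd.lean`; [OURS · L1 G1] replaces the role of: nothing printed — scoring kernels; NOT a statement of the manuscript.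
HONEST FRAMING. Nothing here is a statement of H. Hironaka's manuscript *Resolution of singularities in positive characteristics*
(2017-03-23, [Hironaka2017], lit key `paper:url-3343fd9e678b`): Def. 5.1 / Eq. (36) (p.25 L31–L44) enters only as the typed SHAPE
(row 008) re-based on `ρ^e(O)` by the OURS carriers SW / SWρ, a CANDIDATE [claim: Hironaka2017, status: under-review];
`sandwichRhoFamily`, `sandwichFamily`, `polyTaylorHS` are OURS model data. Scored-cell bookkeeping, not a verdict; AI kernel work,
weaker than expert review; nothing here is progress on resolution of singularities in positive characteristic; no claim beyond the
kernel.
-/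

noncomputable section

set_option linter.dupNamespace false -- mandated namespace of this single-conjunct summit

namespace Summit.ResolutionOfSingularities.ResolutionOfSingularities.Theorems.Campaign.PnegaObligation

open Literature.AlgebraicGeometry.Resolution
open Literature.AlgebraicGeometry.Hironaka2017
open Finsupp

universe u v w
/-! ## §4 ✗ FOR THE GUARDED FAMILY (Def. 5.1's index range `dm ≥ |a|`): the boundary summand `d·m = a` escapes — parametric
witness at a `(y)`-adic placement, class regime `m = p^e`, every `e ≥ 1`, for SWρ and for SW -/

section Witness

variable {O : Type v} [CommRing O] (p : ℕ) [Fact p.Prime] [CharP O p] {σ : Type w}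

/-- **Lower bound** at a `(y)`-adic placement `P n = (y^n)`, class regime `m = q := p^e`: `y^{q+1} ∈ ℘̃_swρ(E,−q)` — summand
`d = 1` (`|q| ≤ 1·q`), operator `∂ = id` (order `0 ≤ 2q`), source `y^{q+1} ∈ ℘posi(E,q) = (y^q)`. [folklore] -/
theorem pow_succ_mem_sandwichRhoFamily (e : ℕ) {y : O} (P : ℕ → Ideal O) (hP : ∀ n, P n = Ideal.span {y ^ n}) :
    y ^ (p ^ e + 1) ∈ sandwichRhoFamily p e P (p ^ e) (-(p ^ e : ℕ)) := by
  have hq : 0 < p ^ e := pow_pos (Fact.out : p.Prime).pos e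
  rw [mem_sandwichRhoFamily_iff, neg_neg]
  unfold sandwichPTildeNegRho
  refine (le_iSup₂ (f := fun (d : ℤ) (_ : |((p ^ e : ℕ) : ℤ)| ≤ d * (p ^ e : ℕ)) =>
    sandwichDDRho p e P (p ^ e) ((p ^ e : ℕ) : ℤ) d) 1 (by rw [Nat.abs_cast]; simp)) ?_
  unfold sandwichDDRho
  refine Submodule.subset_span ⟨LinearMap.id, isDiffOpLE_id.of_le (Nat.zero_le _), y ^ (p ^ e + 1), ?_, rfl⟩
  have h1 : ((1 : ℤ) * (p ^ e : ℕ)).toNat = p ^ e := by rw [one_mul, Int.toNat_natCast]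
  rw [h1]
  unfold S05NegativePart.pPosi
  rw [if_neg hq.ne', hP, Ideal.mem_span_singleton]
  exact ⟨y, by ring⟩

/-- **Upper bound**: `℘̃_swρ(E,−(q+1)) ⊆ (y^{2q})`, `q = p^e = m` — Def. 5.1's guard `|q+1| ≤ dq` forces `d ≥ 2`, each source
`℘posi(E,dq) ⊆ (y^{dq}) = ρ^e(y^d)·O` consists of sandwich constants, so every generator value `∂f` stays in `(y^{dq}) ⊆ (y^{2q})`
(`apply_mem_span_pow_mul_pow`), and `(y^{2q})` is an `O`-ideal, a fortiori a `ρ^e(O)`-module. [folklore] -/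
theorem sandwichRhoFamily_subset_span (e : ℕ) {y : O} (P : ℕ → Ideal O) (hP : ∀ n, P n = Ideal.span {y ^ n}) :
    (sandwichRhoFamily p e P (p ^ e) (-(p ^ e : ℕ) - 1) : Set O) ⊆ (Ideal.span {y ^ (2 * p ^ e)} : Set O) := by
  have hq : 0 < p ^ e := pow_pos (Fact.out : p.Prime).pos e
  intro x hx
  rw [SetLike.mem_coe, mem_sandwichRhoFamily_iff] at hx
  have hneg : -(-((p ^ e : ℕ) : ℤ) - 1) = ((p ^ e : ℕ) : ℤ) + 1 := by ring
  rw [hneg] at hx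
  unfold sandwichPTildeNegRho at hx
  revert hx x
  change (⨆ (d : ℤ) (_ : |((p ^ e : ℕ) : ℤ) + 1| ≤ d * (p ^ e : ℕ)), sandwichDDRho p e P (p ^ e) _ d) ≤
    (Ideal.span {y ^ (2 * p ^ e)}).restrictScalars (↥(iterateFrobenius O p e).range)
  refine iSup₂_le fun d hd => ?_
  -- the guard forces `d ≥ 2`
  have hd2 : (2 : ℤ) ≤ d := by
    have habs : |((p ^ e : ℕ) : ℤ) + 1| = ((p ^ e : ℕ) : ℤ) + 1 := abs_of_nonneg (by positivity)
    rw [habs] at hd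
    by_contra hlt
    push Not at hlt
    have : d * ((p ^ e : ℕ) : ℤ) ≤ 1 * ((p ^ e : ℕ) : ℤ) := by
      apply mul_le_mul_of_nonneg_right (by omega) (by positivity)
    omega
  unfold sandwichDDRho
  refine Submodule.span_le.mpr ?_
  rintro _ ⟨D, _, f, hf, rfl⟩
  have hdn : (d * ((p ^ e : ℕ) : ℤ)).toNat = d.toNat * p ^ e := by
    obtain ⟨k, rfl⟩ := Int.eq_ofNat_of_zero_le (show (0 : ℤ) ≤ d by omega)
    rw [← Nat.cast_mul, Int.toNat_natCast, Int.toNat_natCast]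
  have hf' : f ∈ Ideal.span {y ^ (d.toNat * p ^ e)} := by
    rw [← hP, ← hdn]
    exact pPosi_le P _ hf
  have hDf := apply_mem_span_pow_mul_pow p e D y d.toNat hf'
  refine Ideal.span_singleton_le_span_singleton.mpr (pow_dvd_pow y ?_) hDf
  have : 2 ≤ d.toNat := by omega
  nlinarith

/-- **✗ for SWρ, parametric** (the K13-2 cell): for ANY ring `O` of characteristic `p`, ANY ring homomorphism `T : O → O⟦t_σ⟧`
with `D^{[0]} = id` and an element `y` with `D^{[e_j]} y = 1`, the `(y)`-adic placement `P n = (y^n)`, `m = q = p^e` with `e ≥ 1`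
(so `|e_j| = 1 < q`), and `y^q ∉ (y^{2q})`: **`¬ F3hsBddAt p e T (sandwichRhoFamily p e P q)`**. Witness: `β = e_j`, `i = −q`,
`f = y^{q+1} ∈ ℘̃_swρ(E,−q)` (`pow_succ_mem_sandwichRhoFamily`); by ρ^e-linearity (§2) `D^{[e_j]}(y^q·y) = y^q·D^{[e_j]} y = y^q`,
which is not in `℘̃_swρ(E,−q−1) ⊆ (y^{2q})` (`sandwichRhoFamily_subset_span`). The failing summand is the BOUNDARY one,
`d·m = a = q`. [folklore] -/
theorem not_F3hsBddAt_sandwichRhoFamily [DecidableEq σ] (T : O →+* MvPowerSeries σ O)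
    (hT0 : ∀ b, MvPowerSeries.constantCoeff (T b) = b) {j : σ} {y : O}
    (hy : hsComponent T (single j 1) y = 1) (P : ℕ → Ideal O) (hP : ∀ n, P n = Ideal.span {y ^ n})
    {e : ℕ} (he : 1 ≤ e) (hyq : y ^ p ^ e ∉ Ideal.span {y ^ (2 * p ^ e)}) :
    ¬ F3hsBddAt p e T (sandwichRhoFamily p e P (p ^ e)) := by
  intro h
  have hp2 : 2 ≤ p := (Fact.out : p.Prime).two_le
  have hq2 : 2 ≤ p ^ e := by
    calc (2 : ℕ) ≤ p := hp2
      _ = p ^ 1 := (pow_one p).symm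
      _ ≤ p ^ e := Nat.pow_le_pow_right (by omega) he
  have hdeg : degree (single j 1 : σ →₀ ℕ) = 1 := by rw [degree_single]
  have hmem := h (single j 1) (by rw [hdeg]; exact Nat.one_pos) (by rw [hdeg]; omega)
    (-(p ^ e : ℕ)) (by have := pow_pos (Fact.out : p.Prime).pos e; omega) _
    (pow_succ_mem_sandwichRhoFamily p e P hP)
  rw [hdeg, Nat.cast_one, pow_succ, hsComponent_pow_pow_mul p T hT0 e (by rw [hdeg]; omega),
    hy, mul_one] at hmem
  exact hyq (sandwichRhoFamily_subset_span p e P hP hmem)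


/-! ### The same for the `O`-IDEAL sandwich SW (`Campaign.sandwichPTildeNeg`, W1.2 / `MarkedTransferCampaignW12SandwichTSharp.lean`) -/

/-- **SWρ ⊆ SW degree-wise** (the `ρ^e(O)`-span of a generator set lies in its `O`-span; summand by summand
`Campaign.sandwichDDRho_subset`, then over Def. 5.1's index range). [folklore] -/
theorem sandwichRhoFamily_le_sandwichFamily (e : ℕ) (P : ℕ → Ideal O) (m : ℕ) (i : ℤ) :
    sandwichRhoFamily p e P m i ≤ sandwichFamily p e P m i := by
  intro x hx
  rw [mem_sandwichRhoFamily_iff] at hx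
  rw [mem_sandwichFamily_iff]
  unfold sandwichPTildeNegRho at hx
  unfold sandwichPTildeNeg S05NegativePart.pTildeNeg
  revert x
  change (⨆ (d : ℤ) (_ : |(-i)| ≤ d * m), sandwichDDRho p e P m (-i) d) ≤
    (⨆ (d : ℤ) (_ : |(-i)| ≤ d * m), S05NegativePart.DD (↥(iterateFrobenius O p e).range) P m (-i) d).restrictScalars
      (↥(iterateFrobenius O p e).range)
  refine iSup₂_le fun d hd x hx => ?_
  have hx' : x ∈ sandwichDD p e P m (-i) d := sandwichDDRho_subset p e P m (-i) d hx
  exact (le_iSup₂ (f := fun (d : ℤ) (_ : |(-i)| ≤ d * m) =>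
    S05NegativePart.DD (↥(iterateFrobenius O p e).range) P m (-i) d) d hd) hx'

/-- **Upper bound for SW**: `℘̃_sw(E,−(q+1)) ⊆ (y^{2q})` — as for SWρ: `d ≥ 2` forced, and the IDEAL `Diff^{(·)}_{O/ρ^e(O)}((y^{dq}))`
generated by the sandwich-operator values stays inside the `O`-ideal `(y^{dq})` (`Resolution.diffIdeal_le_iff`). [folklore] -/
theorem sandwichFamily_subset_span (e : ℕ) {y : O} (P : ℕ → Ideal O) (hP : ∀ n, P n = Ideal.span {y ^ n}) :
    (sandwichFamily p e P (p ^ e) (-(p ^ e : ℕ) - 1) : Set O) ⊆ (Ideal.span {y ^ (2 * p ^ e)} : Set O) := by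
  have hq : 0 < p ^ e := pow_pos (Fact.out : p.Prime).pos e
  intro x hx
  rw [SetLike.mem_coe, mem_sandwichFamily_iff] at hx
  have hneg : -(-((p ^ e : ℕ) : ℤ) - 1) = ((p ^ e : ℕ) : ℤ) + 1 := by ring
  rw [hneg] at hx
  unfold sandwichPTildeNeg S05NegativePart.pTildeNeg at hx
  revert hx x
  change (⨆ (d : ℤ) (_ : |((p ^ e : ℕ) : ℤ) + 1| ≤ d * (p ^ e : ℕ)),
      S05NegativePart.DD (↥(iterateFrobenius O p e).range) P (p ^ e) _ d) ≤ Ideal.span {y ^ (2 * p ^ e)}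
  refine iSup₂_le fun d hd => ?_
  have hd2 : (2 : ℤ) ≤ d := by
    have habs : |((p ^ e : ℕ) : ℤ) + 1| = ((p ^ e : ℕ) : ℤ) + 1 := abs_of_nonneg (by positivity)
    rw [habs] at hd
    by_contra hlt
    push Not at hlt
    have : d * ((p ^ e : ℕ) : ℤ) ≤ 1 * ((p ^ e : ℕ) : ℤ) := by
      apply mul_le_mul_of_nonneg_right (by omega) (by positivity)
    omega
  unfold S05NegativePart.DD
  refine (diffIdeal_le_iff _).mpr fun D _ f hf => ?_
  have hdn : (d * ((p ^ e : ℕ) : ℤ)).toNat = d.toNat * p ^ e := by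
    obtain ⟨k, rfl⟩ := Int.eq_ofNat_of_zero_le (show (0 : ℤ) ≤ d by omega)
    rw [← Nat.cast_mul, Int.toNat_natCast, Int.toNat_natCast]
  have hf' : f ∈ Ideal.span {y ^ (d.toNat * p ^ e)} := by
    rw [← hP, ← hdn]
    exact pPosi_le P _ hf
  have hDf := apply_mem_span_pow_mul_pow p e D y d.toNat hf'
  refine Ideal.span_singleton_le_span_singleton.mpr (pow_dvd_pow y ?_) hDf
  have : 2 ≤ d.toNat := by omega
  nlinarith

/-- **✗ for SW, parametric**: under the hypotheses of `not_F3hsBddAt_sandwichRhoFamily`,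
**`¬ F3hsBddAt p e T (sandwichFamily p e P q)`** — same witness (`y^{q+1} ∈ ℘̃_swρ(E,−q) ⊆ ℘̃_sw(E,−q)`,
`D^{[e_j]} y^{q+1} = y^q ∉ (y^{2q}) ⊇ ℘̃_sw(E,−q−1)`). [folklore] -/
theorem not_F3hsBddAt_sandwichFamily [DecidableEq σ] (T : O →+* MvPowerSeries σ O)
    (hT0 : ∀ b, MvPowerSeries.constantCoeff (T b) = b) {j : σ} {y : O}
    (hy : hsComponent T (single j 1) y = 1) (P : ℕ → Ideal O) (hP : ∀ n, P n = Ideal.span {y ^ n})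
    {e : ℕ} (he : 1 ≤ e) (hyq : y ^ p ^ e ∉ Ideal.span {y ^ (2 * p ^ e)}) :
    ¬ F3hsBddAt p e T (sandwichFamily p e P (p ^ e)) := by
  intro h
  have hp2 : 2 ≤ p := (Fact.out : p.Prime).two_le
  have hq2 : 2 ≤ p ^ e := by
    calc (2 : ℕ) ≤ p := hp2
      _ = p ^ 1 := (pow_one p).symm
      _ ≤ p ^ e := Nat.pow_le_pow_right (by omega) he
  have hdeg : degree (single j 1 : σ →₀ ℕ) = 1 := by rw [degree_single]
  have hmem := h (single j 1) (by rw [hdeg]; exact Nat.one_pos) (by rw [hdeg]; omega)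
    (-(p ^ e : ℕ)) (by have := pow_pos (Fact.out : p.Prime).pos e; omega) _
    (sandwichRhoFamily_le_sandwichFamily p e P (p ^ e) _ (pow_succ_mem_sandwichRhoFamily p e P hP))
  rw [hdeg, Nat.cast_one, pow_succ, hsComponent_pow_pow_mul p T hT0 e (by rw [hdeg]; omega),
    hy, mul_one] at hmem
  exact hyq (sandwichFamily_subset_span p e P hP hmem)

end Witness

/-! ## §5 INSTANCES at the two placements of record (hypothesis-free ✗)

(a) The affine line `K[x] = MvPolynomial (Fin 1) K`, `char K = p`, `P a = (x)^a` — res-type-072's `PnegaObligation.AffineLine` datum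
(`isCharFiltration_idealOfVars_pow`, (37)-pair `(1, x)`), res-D-pv-040's calibration placement; class regime `m = p^e` (F7b-unit ✓
there, pv-040 `sandwich_affineLine_not_isUnit`, so the ✗ is not a box artefact). (b) `K[x]_{(x)} = OriginLocalization K 1`,
`P a = 𝔪^a` (`isCharFiltration_maximalIdeal_pow`, `…G1PnegaSqueezeV3.lean`), with the TREE's Taylor homomorphism
`Resolution.OriginLocalization.taylorHS K 1` — the HS system the K13-1 kernel `…G1PnegaOriginHsDatum.lean` (p492822) feeds to
`PnegaInterfaceV3.not_nonVanishing_of_hsLocalDatum`. -/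

section AffineLine

open MvPolynomial

variable (K : Type u) [Field K] (p : ℕ) [Fact p.Prime] [CharP K p]

-- `(x)^n = (x^n)` on the affine line: the tree's `Campaign.W12.idealOfVars_fin_one_pow` (p493564) is reused (gate dedup).

/-- `x^q ∉ (x^{2q})` in `K[x]` for `q ≥ 1` (monomial divisibility). [folklore] -/
theorem X_pow_not_mem_span_X_pow_two_mul {q : ℕ} (hq : 1 ≤ q) :
    (X 0 : MvPolynomial (Fin 1) K) ^ q ∉ Ideal.span {(X 0 : MvPolynomial (Fin 1) K) ^ (2 * q)} := by
  intro h
  rw [Ideal.mem_span_singleton, X_pow_eq_monomial, X_pow_eq_monomial, monomial_dvd_monomial] at h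
  obtain ⟨h1 | h1, -⟩ := h
  · exact one_ne_zero h1
  · have := h1 0
    simp only [Finsupp.single_eq_same] at this
    omega

/-- **✗ at the affine line, EVERY Hasse–Schmidt system with `D^{[1]} x = 1`**: for `char K = p`, `e ≥ 1`, and every ring
homomorphism `T : K[x] → K[x]⟦t⟧` with `D^{[0]} = id`, `D^{[1]} x = 1`, the SWρ family of the `(x)`-adic placement with `m = p^e`
FAILS F3hs^{<p^e}. [folklore] -/
theorem not_F3hsBddAt_sandwichRhoFamily_affineLine
    (T : MvPolynomial (Fin 1) K →+* MvPowerSeries (Fin 1) (MvPolynomial (Fin 1) K))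
    (hT0 : ∀ b, MvPowerSeries.constantCoeff (T b) = b) (hTx : hsComponent T (single 0 1) (X 0) = 1)
    {e : ℕ} (he : 1 ≤ e) :
    ¬ F3hsBddAt p e T (sandwichRhoFamily p e (fun a : ℕ => idealOfVars (Fin 1) K ^ a) (p ^ e)) :=
  not_F3hsBddAt_sandwichRhoFamily p T hT0 hTx _ (W12.idealOfVars_fin_one_pow K) he
    (X_pow_not_mem_span_X_pow_two_mul K (Nat.one_le_pow e p (Fact.out : p.Prime).pos))

/-- `D^{[e_i]} x_i = 1` for the integer Taylor coefficients (`x_i(Y+Z) = x_i + Z_i`). [folklore] -/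
theorem taylorCoeff_single_one_X (σ : Type w) (R : Type v) [CommRing R] (i : σ) :
    Literature.NumberTheory.Transcendental.Taylor.taylorCoeff (single i 1) (X i : MvPolynomial σ R) = 1 := by
  classical
  unfold Literature.NumberTheory.Transcendental.Taylor.taylorCoeff
  rw [Literature.NumberTheory.Transcendental.Taylor.shift_X, coeff_add, coeff_X_same, coeff_C, if_neg, zero_add]
  exact fun h : (0 : σ →₀ ℕ) = single i 1 => one_ne_zero (Finsupp.single_eq_zero.mp h.symm)

/-- [OURS · model data] The polynomial Taylor homomorphism `f ↦ f(x + t) = Σ_β D^{[β]}(f) t^β` of `R[x_σ]` into `R[x_σ]⟦t_σ⟧`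
(the tree's `Literature.NumberTheory.Transcendental.Taylor.shift` followed by the inclusion of polynomials into power series;
compare `Resolution.OriginLocalization.taylorHSPoly`, which pushes the coefficients to `k[x]_{(x)}`). Its components are the
Hasse–Schmidt derivatives `Taylor.taylorCoeff β` (`hsComponent_polyTaylorHS`). Model datum witnessing that the hypotheses of
`not_F3hsBddAt_sandwichRhoFamily_affineLine` are inhabited on `K[x]` itself. [cite: Matsumura1987, §27 (higher derivations)] -/
def polyTaylorHS (σ : Type w) (R : Type v) [CommRing R] :
    MvPolynomial σ R →+* MvPowerSeries σ (MvPolynomial σ R) :=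
  (MvPolynomial.coeToMvPowerSeries.ringHom).comp
    (Literature.NumberTheory.Transcendental.Taylor.shift : MvPolynomial σ R →ₐ[R] _).toRingHom

/-- The components of `polyTaylorHS` are the integer Taylor coefficients `taylorCoeff β`. [folklore] -/
theorem hsComponent_polyTaylorHS (σ : Type w) (R : Type v) [CommRing R] (β : σ →₀ ℕ) (f : MvPolynomial σ R) :
    hsComponent (polyTaylorHS σ R) β f = Literature.NumberTheory.Transcendental.Taylor.taylorCoeff β f := by
  change MvPowerSeries.coeff β
    (↑(Literature.NumberTheory.Transcendental.Taylor.shift f) : MvPowerSeries σ (MvPolynomial σ R)) = _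
  rw [MvPolynomial.coeff_coe]
  rfl

/-- `D^{[0]} = id` for `polyTaylorHS` (`f(x + 0) = f(x)`). [folklore] -/
theorem constantCoeff_polyTaylorHS (σ : Type w) (R : Type v) [CommRing R] (f : MvPolynomial σ R) :
    MvPowerSeries.constantCoeff (polyTaylorHS σ R f) = f := by
  rw [← MvPowerSeries.coeff_zero_eq_constantCoeff_apply]
  change hsComponent (polyTaylorHS σ R) 0 f = f
  rw [hsComponent_polyTaylorHS, Literature.NumberTheory.Transcendental.Taylor.taylorCoeff_zero_index]

/-- `D^{[e_i]} x_i = 1` for `polyTaylorHS`. [folklore] -/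
theorem hsComponent_polyTaylorHS_single_one_X (σ : Type w) (R : Type v) [CommRing R] (i : σ) :
    hsComponent (polyTaylorHS σ R) (single i 1) (X i) = 1 := by
  rw [hsComponent_polyTaylorHS, taylorCoeff_single_one_X]

/-- **✗ at the affine line with the polynomial Taylor system** — hypothesis-free instance of the K13-2 cell for SWρ:
`char K = p`, `e ≥ 1`, `m = p^e`, `P a = (x)^a`. [folklore] -/
theorem not_F3hsBddAt_sandwichRhoFamily_affineLine_taylor {e : ℕ} (he : 1 ≤ e) :
    ¬ F3hsBddAt p e (polyTaylorHS (Fin 1) K)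
      (sandwichRhoFamily p e (fun a : ℕ => idealOfVars (Fin 1) K ^ a) (p ^ e)) :=
  not_F3hsBddAt_sandwichRhoFamily_affineLine K p _ (constantCoeff_polyTaylorHS (Fin 1) K)
    (hsComponent_polyTaylorHS_single_one_X (Fin 1) K 0) he

/-- **✗ for the SW ideals at the affine line with the polynomial Taylor system** (hypothesis-free). [folklore] -/
theorem not_F3hsBddAt_sandwichFamily_affineLine_taylor {e : ℕ} (he : 1 ≤ e) :
    ¬ F3hsBddAt p e (polyTaylorHS (Fin 1) K)
      (sandwichFamily p e (fun a : ℕ => idealOfVars (Fin 1) K ^ a) (p ^ e)) :=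
  not_F3hsBddAt_sandwichFamily p _ (constantCoeff_polyTaylorHS (Fin 1) K)
    (hsComponent_polyTaylorHS_single_one_X (Fin 1) K 0) _ (W12.idealOfVars_fin_one_pow K) he
    (X_pow_not_mem_span_X_pow_two_mul K (Nat.one_le_pow e p (Fact.out : p.Prime).pos))

end AffineLine

section Origin

open MvPolynomial IsLocalRing

variable (K : Type u) [Field K] (p : ℕ)

/-- `K[x]_{(x)}` has characteristic `p` when `K` has (the structure map of a field into a non-trivial ring is injective).
Stated as a theorem, to be introduced with `haveI` (no instance declared). [folklore] -/
theorem charP_originLocalization [CharP K p] : CharP (OriginLocalization K 1) p :=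
  charP_of_injective_algebraMap (algebraMap K (OriginLocalization K 1)).injective p

/-- `𝔪 = (x)` in `K[x]_{(x)}` (`IsLocalization.AtPrime.map_eq_maximalIdeal` and `originIdeal = (x)`). [folklore] -/
theorem maximalIdeal_originLocalization_one_eq_span :
    maximalIdeal (OriginLocalization K 1) =
      Ideal.span {algebraMap (MvPolynomial (Fin 1) K) (OriginLocalization K 1) (X 0)} := by
  rw [← IsLocalization.AtPrime.map_eq_maximalIdeal (originIdeal K 1) (OriginLocalization K 1)]
  have h2 := congrArg (Ideal.map (algebraMap (MvPolynomial (Fin 1) K) (OriginLocalization K 1)))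
    (originIdeal_eq_span K 1)
  rw [h2, Ideal.map_span, Set.range_unique, Set.image_singleton]
  rfl

/-- `𝔪^n = (x^n)` in `K[x]_{(x)}`. [folklore] -/
theorem maximalIdeal_originLocalization_one_pow (n : ℕ) :
    maximalIdeal (OriginLocalization K 1) ^ n =
      Ideal.span {algebraMap (MvPolynomial (Fin 1) K) (OriginLocalization K 1) (X 0) ^ n} := by
  rw [maximalIdeal_originLocalization_one_eq_span, Ideal.span_singleton_pow]

/-- `D^{[1]} x = 1` for the tree's Taylor homomorphism `taylorHS K 1` of `K[x]_{(x)}` (on polynomials its components are the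
integer Taylor coefficients, `Resolution.OriginLocalization.hsComponent_taylorHS_algebraMap`). [folklore] -/
theorem hsComponent_taylorHS_single_one_X :
    hsComponent (OriginLocalization.taylorHS K 1) (single 0 1)
      (algebraMap (MvPolynomial (Fin 1) K) (OriginLocalization K 1) (X 0)) = 1 := by
  rw [OriginLocalization.hsComponent_taylorHS_algebraMap, taylorCoeff_single_one_X, map_one]

/-- `x^q ∉ (x^{2q}) = 𝔪^{2q}` in `K[x]_{(x)}` for `q ≥ 1` (a polynomial of total degree `q < 2q`,
`Resolution.algebraMap_mvPolynomial_not_mem_maximalIdeal_pow`). [folklore] -/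
theorem X_pow_not_mem_span_originLocalization {q : ℕ} (hq : 1 ≤ q) :
    algebraMap (MvPolynomial (Fin 1) K) (OriginLocalization K 1) (X 0) ^ q ∉
      Ideal.span {algebraMap (MvPolynomial (Fin 1) K) (OriginLocalization K 1) (X 0) ^ (2 * q)} := by
  rw [← maximalIdeal_originLocalization_one_pow, ← map_pow]
  exact algebraMap_mvPolynomial_not_mem_maximalIdeal_pow (originIdeal K 1) (OriginLocalization K 1)
    (pow_ne_zero q (X_ne_zero 0)) (by rw [totalDegree_X_pow]; omega)

/-- **✗ at `K[x]_{(x)}` with the tree's Taylor system** (placement of record of K13-1): for `e ≥ 1`, `m = p^e`, `P a = 𝔪^a`, the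
SWρ family FAILS F3hs^{<p^e} for `taylorHS K 1`. The characteristic of the placement is taken as an instance hypothesis here
(supplied from `char K = p` in the primed version). [folklore] -/
theorem not_F3hsBddAt_sandwichRhoFamily_originLocalization [Fact p.Prime] [CharP (OriginLocalization K 1) p]
    {e : ℕ} (he : 1 ≤ e) :
    ¬ F3hsBddAt p e (OriginLocalization.taylorHS K 1)
      (sandwichRhoFamily p e (fun a : ℕ => maximalIdeal (OriginLocalization K 1) ^ a) (p ^ e)) :=
  not_F3hsBddAt_sandwichRhoFamily p _ (OriginLocalization.constantCoeff_taylorHS K 1)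
    (hsComponent_taylorHS_single_one_X K) _ (maximalIdeal_originLocalization_one_pow K) he
    (X_pow_not_mem_span_originLocalization K (Nat.one_le_pow e p (Fact.out : p.Prime).pos))

/-- **The K13-2 cell at the placement of record, hypothesis-free**: `char K = p`, `e ≥ 1` ⇒ the SWρ family of `K[x]_{(x)}`
(`P a = 𝔪^a`, `m = p^e`) fails F3hs^{<p^e} for the tree's Taylor homomorphism `taylorHS K 1`. [folklore] -/
theorem not_F3hsBddAt_sandwichRhoFamily_originLocalization' [Fact p.Prime] [CharP K p] {e : ℕ} (he : 1 ≤ e) :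
    haveI := charP_originLocalization K p
    ¬ F3hsBddAt p e (OriginLocalization.taylorHS K 1)
      (sandwichRhoFamily p e (fun a : ℕ => maximalIdeal (OriginLocalization K 1) ^ a) (p ^ e)) := by
  haveI := charP_originLocalization K p
  exact not_F3hsBddAt_sandwichRhoFamily_originLocalization K p he

/-- **✗ for the SW ideals at `K[x]_{(x)}`** with the tree's Taylor homomorphism, hypothesis-free. [folklore] -/
theorem not_F3hsBddAt_sandwichFamily_originLocalization [Fact p.Prime] [CharP K p] {e : ℕ} (he : 1 ≤ e) :
    haveI := charP_originLocalization K p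
    ¬ F3hsBddAt p e (OriginLocalization.taylorHS K 1)
      (sandwichFamily p e (fun a : ℕ => maximalIdeal (OriginLocalization K 1) ^ a) (p ^ e)) := by
  haveI := charP_originLocalization K p
  exact not_F3hsBddAt_sandwichFamily p _ (OriginLocalization.constantCoeff_taylorHS K 1)
    (hsComponent_taylorHS_single_one_X K) _ (maximalIdeal_originLocalization_one_pow K) he
    (X_pow_not_mem_span_originLocalization K (Nat.one_le_pow e p (Fact.out : p.Prime).pos))

end Origin

end Summit.ResolutionOfSingularities.ResolutionOfSingularities.Theorems.Campaign.PnegaObligation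

end
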